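import Summits.QuantumFields.BalabanUV.Beta.GAN24.ContactFaceJumpCommutator

/-!
# `BalabanUV.Beta.GAN24.ContactFaceJumpBorder` — binder row G-an2-4 / (CONV-C), CT-ROUTE, the row owner's `gen20/BORNSEC-PLAN-v1.md` v1.1 §0 (V paragraph) ∕ §A (V half) «the same
# (C3)–(C6)», PART 4 of «FACE-JUMP»: **THE TWO-SITE WEIGHTS OF THE BORDER (V∕H) CONTACT CELLS — TIP `ψ(z+e_b) − ψ(L·y+ρ+L·e_μ)` AND ROOT `ψ(L·y+ρ) − ψ z` — ARE THE SAME ONE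
# FACE JUMP on the support of `q¹,ρ_{(μ,y)}`; for staircases the SAME crossed-scale letter `J(μ,y)` as the Λ half; at the commutator level leaf-02 g48's two-site commutators are localised**

NOT IN PRINT; OUR BOOKKEEPING (G-an2-4 formalisation swarm → CRUX TEAM (2), leaf prover `b2b-balaban-gan24-formalise-leaf-01`, gen 60; INTENT «FACE-JUMP-V» journal `CLAIMS.log`
l.34114; names PROVISIONAL).  [folklore] bookkeeping over PART 1 `ContactFaceJump` (two-block support `linCountAt_eq_zero_of_not_twoBlock`, `blk_root ∕ blk_farRoot`), PART 2
`ContactFaceJumpStaircase` (`staircase_split`, `abs_hplus_jump_le`), leaf-02 g48's `ContactLambdaCommutator.linAvgAt_eq_sum_linCountAt` BY NAME; 0 `def`, 0 cited facts, 0 `def … : Prop`,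
0 sorry.  The objects are the TIP ∕ ROOT two-site weights of leaf-02 g48's «V-CELL COMMUTATOR» `ContactBorderCommutator` (`tsum_sum_mul_tipWeight_mul_linSymAt` ∕ `…rootWeight…`),
which this file does NOT import (the statements sit on an1's `linCountAt` ∕ `linAvgAt`).  HONEST FRAMING (cell contract, verbatim): «discharging `BetaPertH` makes Bałaban's UV
stability UNCONDITIONAL — a real constructive-QFT result; it is NOT the continuum limit and NOT the Clay problem.»  HONEST DEPENDENCY (verbatim): «continuum YM on T⁴ ⇐
BetaPertH ∧ nine spine estimates (0/9 proved); BetaPertH ⇐ (D1) ∧ (D4) ∧ CAP+tail; G-an2-4 gates asym, D1 and NE2/3/4.»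

## What (generic `d`; box root `ρ = toSite r`, `r ∈ box (d+1) L`, `1 ≤ L`)
* §1 BLOCK-CONSTANT `ψ = h ∘ blk L`, EVERY bond `(b,z)`: **`abs_tipWeight_mul_linCountAt_le`** (`|(ψ(z+e_b) − ψ(L·y+ρ+L·e_μ))·count(b,z)| ≤ |h(y+e_μ) − h y|·|count(b,z)|`),
  **`abs_rootWeight_mul_linCountAt_le`** (`|(ψ(L·y+ρ) − ψ z)·count(b,z)| ≤ |h(y+e_μ) − h y|·|count(b,z)|`), their `linKerAt` forms, the monotonicity `blk_apply_le_blk_add_unitVec_apply`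
  (a bond never climbs DOWN a block), and the EXACT border ΔΔ identity **`tipWeight_mul_dz_mul_linCountAt_eq_zero`** (`(h_a(blk(z+e_b)) − h_a(y+e_μ))·(h_b(blk(z+e_b)) − h_b(blk z))·count = 0`:
  an interior bond has difference `0`, the crossing bond has tip label `y+e_μ` hence tip weight `0` — the «downward» crossing is excluded by monotonicity).
* §2 STAIRCASES (one step `L = Lc`): **`abs_tipWeight_staircase_mul_linCountAt_le`** ∕ **`abs_rootWeight_staircase_mul_linCountAt_le`** — `≤ (|two-site weight of G 0| + J(μ,y))·|count|`
  with the SAME `J(μ,y) = Σ_{s<n} |G (s+1) (blk (Lc^s) (y+e_μ)) − G (s+1) (blk (Lc^s) y)|` as PART 2 (so PART 2's `jump_eq_zero_of_not_dvd` ∕ `sum_abs_jump_le` and leaf-03 g54's (C5) apply verbatim).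
* §3 COMMUTATOR LEVEL: `tipCommutator_eq_sum` ∕ `rootCommutator_eq_sum` (leaf-02's expansion), **`abs_tipCommutator_le_of_staircase_of_le`**
  (`|linAvgAt ρ (fun κ u ↦ ψ(u+e_κ)·T κ u) L μ y − ψ(L·y+ρ+L·e_μ)·linAvgAt ρ T L μ y| ≤ (W⁺ + J(μ,y))·M·Σ_{x∈nearBox} Σ_α |count(α,x)|`) and **`abs_rootCommutator_le_of_staircase_of_le`**
  (`|ψ(L·y+ρ)·linAvgAt ρ T L μ y − linAvgAt ρ (fun a x ↦ ψ x·T a x) L μ y| ≤ (W⁻ + J(μ,y))·M·Σ|count|`).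
USE ((V-C), owner ∕ crux team): the V-born cells of `ContactBorderCommutator.contact_border_fm∕mf_eq_factorised` read `(multiplier leg = wΦ-tent, M-V) × (two-site commutator)`; with this file
and (C5) the V half's count is the Λ half's `(k−i)·Lc^{−(k−i)}`.  Discharges NO slot letter; NO estimate of Bałaban's; 0 wall binders; NEVER «G-an2-4 closed»; NOT D1, NOT BetaPertH,
NOT continuum, NOT Clay.
-/

noncomputable section

open Finset
open scoped BigOperators
open Literature.MathematicalPhysics.QuantumFieldTheory
open Literature.MathematicalPhysics.QuantumFieldTheory.Balaban1983to89
open Literature.MathematicalPhysics.QuantumFieldTheory.Balaban1983to89.Beta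
open AffineAveraging (Form0 Form1 Site box toSite unitVec unitVec_apply dz)
open AveragingContours (blk blk_block)
open AveragingContoursRooted (linAvgAt)
open AveragingHessianKernelsRooted (linCountAt linKerAt)
open Summit.QuantumFields.BalabanUV.Beta.LinearGaugeVH (nearBox mem_nearBox)
open Summit.QuantumFields.BalabanUV.Beta.GAN24.ContactLambdaCommutator (linAvgAt_eq_sum_linCountAt)
open Summit.QuantumFields.BalabanUV.Beta.GAN24.ContactFaceJump (linCountAt_eq_zero_of_not_twoBlock linKerAt_eq_zero_of_not_twoBlock blk_root blk_farRoot)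
open Summit.QuantumFields.BalabanUV.Beta.GAN24.ContactFaceJumpStaircase (staircase_split abs_hplus_jump_le)

namespace Summit.QuantumFields.BalabanUV.Beta.GAN24.ContactFaceJumpBorder

variable {d : ℕ} {L : ℕ} {r : Fin (d + 1) → ℕ}

/-! ## §1 Block-constant gauge functions: the tip and root two-site weights are the one face jump -/

section BlockConstant

/-- [folklore] Tip label in `{y, y+e_μ}` ⇒ `|h(tip label) − h(y+e_μ)| ≤ |h(y+e_μ) − h y|` (it is `0` or `−Δ`). -/
theorem abs_tipSite_le (h : Site (d + 1) → ℝ) {μ : Fin (d + 1)} {y z' : Site (d + 1)} (hz' : blk L z' = y ∨ blk L z' = y + unitVec μ) :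
    |h (blk L z') - h (y + unitVec μ)| ≤ |h (y + unitVec μ) - h y| := by
  rcases hz' with e | e <;> rw [e]
  · exact (abs_sub_comm _ _).le
  · rw [sub_self, abs_zero]; exact abs_nonneg _

/-- [folklore] Base label in `{y, y+e_μ}` ⇒ `|h y − h(base label)| ≤ |h(y+e_μ) − h y|` (it is `0` or `−Δ`). -/
theorem abs_rootSite_le (h : Site (d + 1) → ℝ) {μ : Fin (d + 1)} {y z : Site (d + 1)} (hz : blk L z = y ∨ blk L z = y + unitVec μ) :
    |h y - h (blk L z)| ≤ |h (y + unitVec μ) - h y| := by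
  rcases hz with e | e <;> rw [e]
  · rw [sub_self, abs_zero]; exact abs_nonneg _
  · exact (abs_sub_comm _ _).le

/-- NOT IN PRINT; OUR BOOKKEEPING.  **THE TIP WEIGHT OF THE BORDER CELL IS THE ONE FACE JUMP** (box root, `ψ = h ∘ blk L`, EVERY bond `(b,z)`):
`|(ψ(z+e_b) − ψ(L·y+ρ+L·e_μ))·linCountAt ρ L μ y (b,z)| ≤ |h(y+e_μ) − h y|·|linCountAt ρ L μ y (b,z)|`. -/
theorem abs_tipWeight_mul_linCountAt_le (hL : 1 ≤ L) (hr : r ∈ box (d + 1) L) {ψ : Site (d + 1) → ℝ} (h : Site (d + 1) → ℝ)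
    (hψ : ∀ u, ψ u = h (blk L u)) (μ : Fin (d + 1)) (y : Site (d + 1)) (b : Fin (d + 1)) (z : Site (d + 1)) :
    |(ψ (z + unitVec b) - ψ ((L : ℤ) • y + toSite r + (L : ℤ) • unitVec μ)) * (linCountAt (toSite r) L μ y (b, z) : ℝ)|
      ≤ |h (y + unitVec μ) - h y| * |(linCountAt (toSite r) L μ y (b, z) : ℝ)| := by
  simp only [hψ, blk_farRoot y μ hr]
  rw [abs_mul]
  by_cases hq : (blk L z = y ∨ blk L z = y + unitVec μ) ∧ (blk L (z + unitVec b) = y ∨ blk L (z + unitVec b) = y + unitVec μ)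
  · exact mul_le_mul_of_nonneg_right (abs_tipSite_le h hq.2) (abs_nonneg _)
  · rw [linCountAt_eq_zero_of_not_twoBlock (f := (b, z)) hL hr hq, Int.cast_zero, abs_zero, mul_zero, mul_zero]

/-- NOT IN PRINT; OUR BOOKKEEPING.  **THE ROOT WEIGHT OF THE BORDER CELL IS THE ONE FACE JUMP** (box root, `ψ = h ∘ blk L`, EVERY bond `(b,z)`):
`|(ψ(L·y+ρ) − ψ z)·linCountAt ρ L μ y (b,z)| ≤ |h(y+e_μ) − h y|·|linCountAt ρ L μ y (b,z)|`. -/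
theorem abs_rootWeight_mul_linCountAt_le (hL : 1 ≤ L) (hr : r ∈ box (d + 1) L) {ψ : Site (d + 1) → ℝ} (h : Site (d + 1) → ℝ)
    (hψ : ∀ u, ψ u = h (blk L u)) (μ : Fin (d + 1)) (y : Site (d + 1)) (b : Fin (d + 1)) (z : Site (d + 1)) :
    |(ψ ((L : ℤ) • y + toSite r) - ψ z) * (linCountAt (toSite r) L μ y (b, z) : ℝ)|
      ≤ |h (y + unitVec μ) - h y| * |(linCountAt (toSite r) L μ y (b, z) : ℝ)| := by
  simp only [hψ, blk_root y hr]
  rw [abs_mul]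
  by_cases hq : (blk L z = y ∨ blk L z = y + unitVec μ) ∧ (blk L (z + unitVec b) = y ∨ blk L (z + unitVec b) = y + unitVec μ)
  · exact mul_le_mul_of_nonneg_right (abs_rootSite_le h hq.1) (abs_nonneg _)
  · rw [linCountAt_eq_zero_of_not_twoBlock (f := (b, z)) hL hr hq, Int.cast_zero, abs_zero, mul_zero, mul_zero]

/-- [folklore] The `linKerAt` form of the tip letter. -/
theorem abs_tipWeight_mul_linKerAt_le (hL : 1 ≤ L) (hr : r ∈ box (d + 1) L) {ψ : Site (d + 1) → ℝ} (h : Site (d + 1) → ℝ)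
    (hψ : ∀ u, ψ u = h (blk L u)) (μ : Fin (d + 1)) (y : Site (d + 1)) (b : Fin (d + 1)) (z : Site (d + 1)) :
    |(ψ (z + unitVec b) - ψ ((L : ℤ) • y + toSite r + (L : ℤ) • unitVec μ)) * linKerAt (toSite r) L μ y (b, z)|
      ≤ |h (y + unitVec μ) - h y| * |linKerAt (toSite r) L μ y (b, z)| := by
  simp only [hψ, blk_farRoot y μ hr]
  rw [abs_mul]
  by_cases hq : (blk L z = y ∨ blk L z = y + unitVec μ) ∧ (blk L (z + unitVec b) = y ∨ blk L (z + unitVec b) = y + unitVec μ)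
  · exact mul_le_mul_of_nonneg_right (abs_tipSite_le h hq.2) (abs_nonneg _)
  · rw [linKerAt_eq_zero_of_not_twoBlock (f := (b, z)) hL hr hq, abs_zero, mul_zero, mul_zero]

/-- [folklore] The `linKerAt` form of the root letter. -/
theorem abs_rootWeight_mul_linKerAt_le (hL : 1 ≤ L) (hr : r ∈ box (d + 1) L) {ψ : Site (d + 1) → ℝ} (h : Site (d + 1) → ℝ)
    (hψ : ∀ u, ψ u = h (blk L u)) (μ : Fin (d + 1)) (y : Site (d + 1)) (b : Fin (d + 1)) (z : Site (d + 1)) :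
    |(ψ ((L : ℤ) • y + toSite r) - ψ z) * linKerAt (toSite r) L μ y (b, z)|
      ≤ |h (y + unitVec μ) - h y| * |linKerAt (toSite r) L μ y (b, z)| := by
  simp only [hψ, blk_root y hr]
  rw [abs_mul]
  by_cases hq : (blk L z = y ∨ blk L z = y + unitVec μ) ∧ (blk L (z + unitVec b) = y ∨ blk L (z + unitVec b) = y + unitVec μ)
  · exact mul_le_mul_of_nonneg_right (abs_rootSite_le h hq.1) (abs_nonneg _)
  · rw [linKerAt_eq_zero_of_not_twoBlock (f := (b, z)) hL hr hq, abs_zero, mul_zero, mul_zero]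

/-- [folklore] A bond never climbs DOWN a block: `(blk L z) i ≤ (blk L (z + e_b)) i` coordinatewise (`1 ≤ L`). -/
theorem blk_apply_le_blk_add_unitVec_apply (hL : 1 ≤ L) (z : Site (d + 1)) (b i : Fin (d + 1)) :
    blk L z i ≤ blk L (z + unitVec b) i := by
  have hL0 : (0 : ℤ) < L := by exact_mod_cast hL
  simp only [blk, Pi.add_apply, unitVec_apply]
  exact Int.ediv_le_ediv hL0 (by split_ifs <;> omega)

/-- NOT IN PRINT; OUR BOOKKEEPING.  **THE BORDER ΔΔ IDENTITY: THE TIP JUMP OF ONE BLOCK-CONSTANT FUNCTION NEVER MULTIPLIES THE GRADIENT OF ANOTHER on the support of `q¹,ρ`**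
(box root, EVERY bond): `(h_a(blk(z+e_b)) − h_a(y+e_μ))·(h_b(blk(z+e_b)) − h_b(blk z))·count(b,z) = 0` for `ψ_a = h_a∘blk L`, `ψ_b = h_b∘blk L` — interior bond: difference `0`; crossing
bond: tip label `y+e_μ`, tip weight `0`; the «downward» crossing (base `y+e_μ`, tip `y`) is excluded by `blk_apply_le_blk_add_unitVec_apply`. -/
theorem tipWeight_mul_dz_mul_linCountAt_eq_zero (hL : 1 ≤ L) (hr : r ∈ box (d + 1) L) {ψa ψb : Site (d + 1) → ℝ} (ha hb : Site (d + 1) → ℝ)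
    (hψa : ∀ u, ψa u = ha (blk L u)) (hψb : ∀ u, ψb u = hb (blk L u)) (μ : Fin (d + 1)) (y : Site (d + 1)) (b : Fin (d + 1)) (z : Site (d + 1)) :
    (ψa (z + unitVec b) - ψa ((L : ℤ) • y + toSite r + (L : ℤ) • unitVec μ)) * (ψb (z + unitVec b) - ψb z)
        * (linCountAt (toSite r) L μ y (b, z) : ℝ) = 0 := by
  simp only [hψa, hψb, blk_farRoot y μ hr]
  by_cases hq : (blk L z = y ∨ blk L z = y + unitVec μ) ∧ (blk L (z + unitVec b) = y ∨ blk L (z + unitVec b) = y + unitVec μ)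
  · obtain ⟨hz | hz, hz' | hz'⟩ := hq
    · rw [hz, hz']; ring
    · rw [hz']; ring
    · -- downward crossing: impossible
      exfalso
      have hmono := blk_apply_le_blk_add_unitVec_apply hL z b μ
      rw [hz, hz', Pi.add_apply, unitVec_apply, if_pos rfl] at hmono
      omega
    · rw [hz, hz']; ring
  · rw [linCountAt_eq_zero_of_not_twoBlock (f := (b, z)) hL hr hq, Int.cast_zero, mul_zero]

end BlockConstant

/-! ## §2 Staircases: the finest piece + the same crossed-scale letter `J(μ,y)` as the Λ half -/

section Staircase

variable {Lc : ℕ} {rr : Fin (d + 1) → ℕ}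

/-- NOT IN PRINT; OUR BOOKKEEPING.  **THE TIP WEIGHT OF A STAIRCASE ON THE SUPPORT**: `|(ψ(z+e_b) − ψ(Lc·y+ρ+Lc·e_μ))·count| ≤ (|G 0 (z+e_b) − G 0 (Lc·y+ρ+Lc·e_μ)| + J(μ,y))·|count|`,
`J(μ,y) = Σ_{s<n} |G (s+1) (blk (Lc^s) (y+e_μ)) − G (s+1) (blk (Lc^s) y)|` (PART 2's letter). -/
theorem abs_tipWeight_staircase_mul_linCountAt_le (hLc : 1 ≤ Lc) (hrr : rr ∈ box (d + 1) Lc) (G : ℕ → Site (d + 1) → ℝ) (n : ℕ)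
    {ψ : Site (d + 1) → ℝ} (hψ : ∀ u, ψ u = ∑ s ∈ Finset.range (n + 1), G s (blk (Lc ^ s) u))
    (μ : Fin (d + 1)) (y : Site (d + 1)) (b : Fin (d + 1)) (z : Site (d + 1)) :
    |(ψ (z + unitVec b) - ψ ((Lc : ℤ) • y + toSite rr + (Lc : ℤ) • unitVec μ)) * (linCountAt (toSite rr) Lc μ y (b, z) : ℝ)|
      ≤ (|G 0 (z + unitVec b) - G 0 ((Lc : ℤ) • y + toSite rr + (Lc : ℤ) • unitVec μ)|
          + ∑ s ∈ Finset.range n, |G (s + 1) (blk (Lc ^ s) (y + unitVec μ)) - G (s + 1) (blk (Lc ^ s) y)|)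
        * |(linCountAt (toSite rr) Lc μ y (b, z) : ℝ)| := by
  set q : ℝ := (linCountAt (toSite rr) Lc μ y (b, z) : ℝ)
  set hp : Site (d + 1) → ℝ := fun y' => ∑ s ∈ Finset.range n, G (s + 1) (blk (Lc ^ s) y') with hhp
  have hψ' : ∀ u, ψ u = G 0 u + hp (blk Lc u) := fun u => by rw [hψ, staircase_split]
  have e : (ψ (z + unitVec b) - ψ ((Lc : ℤ) • y + toSite rr + (Lc : ℤ) • unitVec μ)) * q
      = (G 0 (z + unitVec b) - G 0 ((Lc : ℤ) • y + toSite rr + (Lc : ℤ) • unitVec μ)) * q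
        + ((fun u => hp (blk Lc u)) (z + unitVec b) - (fun u => hp (blk Lc u)) ((Lc : ℤ) • y + toSite rr + (Lc : ℤ) • unitVec μ)) * q := by
    simp only [hψ']; ring
  rw [e, add_mul]
  refine (abs_add_le _ _).trans (add_le_add (le_of_eq (abs_mul _ _)) ?_)
  refine (abs_tipWeight_mul_linCountAt_le hLc hrr hp (fun _ => rfl) μ y b z).trans (mul_le_mul_of_nonneg_right ?_ (abs_nonneg _))
  rw [hhp]
  exact abs_hplus_jump_le G n μ y

/-- NOT IN PRINT; OUR BOOKKEEPING.  **THE ROOT WEIGHT OF A STAIRCASE ON THE SUPPORT**: `|(ψ(Lc·y+ρ) − ψ z)·count| ≤ (|G 0 (Lc·y+ρ) − G 0 z| + J(μ,y))·|count|`. -/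
theorem abs_rootWeight_staircase_mul_linCountAt_le (hLc : 1 ≤ Lc) (hrr : rr ∈ box (d + 1) Lc) (G : ℕ → Site (d + 1) → ℝ) (n : ℕ)
    {ψ : Site (d + 1) → ℝ} (hψ : ∀ u, ψ u = ∑ s ∈ Finset.range (n + 1), G s (blk (Lc ^ s) u))
    (μ : Fin (d + 1)) (y : Site (d + 1)) (b : Fin (d + 1)) (z : Site (d + 1)) :
    |(ψ ((Lc : ℤ) • y + toSite rr) - ψ z) * (linCountAt (toSite rr) Lc μ y (b, z) : ℝ)|
      ≤ (|G 0 ((Lc : ℤ) • y + toSite rr) - G 0 z|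
          + ∑ s ∈ Finset.range n, |G (s + 1) (blk (Lc ^ s) (y + unitVec μ)) - G (s + 1) (blk (Lc ^ s) y)|)
        * |(linCountAt (toSite rr) Lc μ y (b, z) : ℝ)| := by
  set q : ℝ := (linCountAt (toSite rr) Lc μ y (b, z) : ℝ)
  set hp : Site (d + 1) → ℝ := fun y' => ∑ s ∈ Finset.range n, G (s + 1) (blk (Lc ^ s) y') with hhp
  have hψ' : ∀ u, ψ u = G 0 u + hp (blk Lc u) := fun u => by rw [hψ, staircase_split]
  have e : (ψ ((Lc : ℤ) • y + toSite rr) - ψ z) * q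
      = (G 0 ((Lc : ℤ) • y + toSite rr) - G 0 z) * q
        + ((fun u => hp (blk Lc u)) ((Lc : ℤ) • y + toSite rr) - (fun u => hp (blk Lc u)) z) * q := by
    simp only [hψ']; ring
  rw [e, add_mul]
  refine (abs_add_le _ _).trans (add_le_add (le_of_eq (abs_mul _ _)) ?_)
  refine (abs_rootWeight_mul_linCountAt_le hLc hrr hp (fun _ => rfl) μ y b z).trans (mul_le_mul_of_nonneg_right ?_ (abs_nonneg _))
  rw [hhp]
  exact abs_hplus_jump_le G n μ y

end Staircase

/-! ## §3 Commutator level: leaf-02 g48's TIP and ROOT two-site commutators, localised -/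

section Commutator

variable {Lc : ℕ} {rr : Fin (d + 1) → ℕ}

/-- NOT IN PRINT; OUR BOOKKEEPING.  **THE TIP COMMUTATOR OVER BONDS**: `linAvgAt ρ (fun κ u ↦ ψ(u+e_κ)·T κ u) L μ y − ψ(L·y+ρ+L·e_μ)·linAvgAt ρ T L μ y
= Σ_{x∈nearBox L y} Σ_α ((ψ(x+e_α) − ψ(L·y+ρ+L·e_μ))·count(α,x))·T α x`. -/
theorem tipCommutator_eq_sum (hr : r ∈ box (d + 1) L) (ψ : Site (d + 1) → ℝ) (T : Form1 (d + 1) ℝ) (μ : Fin (d + 1)) (y : Site (d + 1)) :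
    linAvgAt (toSite r) (fun α x => ψ (x + unitVec α) * T α x) L μ y - ψ ((L : ℤ) • y + toSite r + (L : ℤ) • unitVec μ) * linAvgAt (toSite r) T L μ y
      = ∑ x ∈ nearBox L y, ∑ α, ((ψ (x + unitVec α) - ψ ((L : ℤ) • y + toSite r + (L : ℤ) • unitVec μ)) * (linCountAt (toSite r) L μ y (α, x) : ℝ)) * T α x := by
  rw [linAvgAt_eq_sum_linCountAt hr, linAvgAt_eq_sum_linCountAt hr T, Finset.mul_sum, ← Finset.sum_sub_distrib]
  refine Finset.sum_congr rfl fun x _ => ?_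
  rw [Finset.mul_sum, ← Finset.sum_sub_distrib]
  refine Finset.sum_congr rfl fun α _ => ?_
  ring

/-- NOT IN PRINT; OUR BOOKKEEPING.  **THE ROOT COMMUTATOR OVER BONDS**: `ψ(L·y+ρ)·linAvgAt ρ T L μ y − linAvgAt ρ (fun a x ↦ ψ x·T a x) L μ y
= Σ_{x∈nearBox L y} Σ_α ((ψ(L·y+ρ) − ψ x)·count(α,x))·T α x`. -/
theorem rootCommutator_eq_sum (hr : r ∈ box (d + 1) L) (ψ : Site (d + 1) → ℝ) (T : Form1 (d + 1) ℝ) (μ : Fin (d + 1)) (y : Site (d + 1)) :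
    ψ ((L : ℤ) • y + toSite r) * linAvgAt (toSite r) T L μ y - linAvgAt (toSite r) (fun α x => ψ x * T α x) L μ y
      = ∑ x ∈ nearBox L y, ∑ α, ((ψ ((L : ℤ) • y + toSite r) - ψ x) * (linCountAt (toSite r) L μ y (α, x) : ℝ)) * T α x := by
  rw [linAvgAt_eq_sum_linCountAt hr T, linAvgAt_eq_sum_linCountAt hr, Finset.mul_sum, ← Finset.sum_sub_distrib]
  refine Finset.sum_congr rfl fun x _ => ?_
  rw [Finset.mul_sum, ← Finset.sum_sub_distrib]
  refine Finset.sum_congr rfl fun α _ => ?_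
  ring

/-- NOT IN PRINT; OUR BOOKKEEPING.  **THE TIP COMMUTATOR OF A STAIRCASE IS LOCALISED** (one step `L = Lc`, box root): with a finest-piece tip letter
`|G 0 (x+e_α) − G 0 (Lc·y+ρ+Lc·e_μ)| ≤ W` and a leg letter `|T α x| ≤ M` on `nearBox Lc y`,
`|linAvgAt ρ (fun κ u ↦ ψ(u+e_κ)·T κ u) Lc μ y − ψ(Lc·y+ρ+Lc·e_μ)·linAvgAt ρ T Lc μ y| ≤ (W + J(μ,y))·M·Σ_{x∈nearBox} Σ_α |count(α,x)|`. -/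
theorem abs_tipCommutator_le_of_staircase_of_le (hLc : 1 ≤ Lc) (hrr : rr ∈ box (d + 1) Lc) (G : ℕ → Site (d + 1) → ℝ) (n : ℕ)
    {ψ : Site (d + 1) → ℝ} (hψ : ∀ u, ψ u = ∑ s ∈ Finset.range (n + 1), G s (blk (Lc ^ s) u)) (T : Form1 (d + 1) ℝ) (μ : Fin (d + 1)) (y : Site (d + 1))
    {W M : ℝ} (hW : ∀ α, ∀ x ∈ nearBox Lc y, |G 0 (x + unitVec α) - G 0 ((Lc : ℤ) • y + toSite rr + (Lc : ℤ) • unitVec μ)| ≤ W)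
    (hT : ∀ α, ∀ x ∈ nearBox Lc y, |T α x| ≤ M) :
    |linAvgAt (toSite rr) (fun α x => ψ (x + unitVec α) * T α x) Lc μ y
        - ψ ((Lc : ℤ) • y + toSite rr + (Lc : ℤ) • unitVec μ) * linAvgAt (toSite rr) T Lc μ y|
      ≤ (W + ∑ s ∈ Finset.range n, |G (s + 1) (blk (Lc ^ s) (y + unitVec μ)) - G (s + 1) (blk (Lc ^ s) y)|) * M
          * ∑ x ∈ nearBox Lc y, ∑ α, |(linCountAt (toSite rr) Lc μ y (α, x) : ℝ)| := by
  rw [tipCommutator_eq_sum hrr, Finset.mul_sum]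
  refine (Finset.abs_sum_le_sum_abs _ _).trans (Finset.sum_le_sum fun x hx => ?_)
  rw [Finset.mul_sum]
  refine (Finset.abs_sum_le_sum_abs _ _).trans (Finset.sum_le_sum fun α _ => ?_)
  have hJ : 0 ≤ ∑ s ∈ Finset.range n, |G (s + 1) (blk (Lc ^ s) (y + unitVec μ)) - G (s + 1) (blk (Lc ^ s) y)| :=
    Finset.sum_nonneg fun _ _ => abs_nonneg _
  have h1 := hW α x hx
  have h2 := hT α x hx
  have hW0 : 0 ≤ W := (abs_nonneg _).trans h1
  have hq := abs_nonneg (linCountAt (toSite rr) Lc μ y (α, x) : ℝ)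
  have hloc := abs_tipWeight_staircase_mul_linCountAt_le hLc hrr G n hψ μ y α x
  rw [abs_mul]
  calc |(ψ (x + unitVec α) - ψ ((Lc : ℤ) • y + toSite rr + (Lc : ℤ) • unitVec μ)) * (linCountAt (toSite rr) Lc μ y (α, x) : ℝ)| * |T α x|
      ≤ ((W + ∑ s ∈ Finset.range n, |G (s + 1) (blk (Lc ^ s) (y + unitVec μ)) - G (s + 1) (blk (Lc ^ s) y)|)
          * |(linCountAt (toSite rr) Lc μ y (α, x) : ℝ)|) * M :=
        mul_le_mul (hloc.trans (mul_le_mul_of_nonneg_right (by linarith) hq)) h2 (abs_nonneg _) (mul_nonneg (by linarith) hq)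
    _ = (W + ∑ s ∈ Finset.range n, |G (s + 1) (blk (Lc ^ s) (y + unitVec μ)) - G (s + 1) (blk (Lc ^ s) y)|) * M
          * |(linCountAt (toSite rr) Lc μ y (α, x) : ℝ)| := by ring

/-- NOT IN PRINT; OUR BOOKKEEPING.  **THE ROOT COMMUTATOR OF A STAIRCASE IS LOCALISED** (one step `L = Lc`, box root): with `|G 0 (Lc·y+ρ) − G 0 x| ≤ W` and `|T α x| ≤ M` on `nearBox Lc y`,
`|ψ(Lc·y+ρ)·linAvgAt ρ T Lc μ y − linAvgAt ρ (fun a x ↦ ψ x·T a x) Lc μ y| ≤ (W + J(μ,y))·M·Σ_{x∈nearBox} Σ_α |count(α,x)|`. -/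
theorem abs_rootCommutator_le_of_staircase_of_le (hLc : 1 ≤ Lc) (hrr : rr ∈ box (d + 1) Lc) (G : ℕ → Site (d + 1) → ℝ) (n : ℕ)
    {ψ : Site (d + 1) → ℝ} (hψ : ∀ u, ψ u = ∑ s ∈ Finset.range (n + 1), G s (blk (Lc ^ s) u)) (T : Form1 (d + 1) ℝ) (μ : Fin (d + 1)) (y : Site (d + 1))
    {W M : ℝ} (hW : ∀ x ∈ nearBox Lc y, |G 0 ((Lc : ℤ) • y + toSite rr) - G 0 x| ≤ W)
    (hT : ∀ α, ∀ x ∈ nearBox Lc y, |T α x| ≤ M) :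
    |ψ ((Lc : ℤ) • y + toSite rr) * linAvgAt (toSite rr) T Lc μ y - linAvgAt (toSite rr) (fun α x => ψ x * T α x) Lc μ y|
      ≤ (W + ∑ s ∈ Finset.range n, |G (s + 1) (blk (Lc ^ s) (y + unitVec μ)) - G (s + 1) (blk (Lc ^ s) y)|) * M
          * ∑ x ∈ nearBox Lc y, ∑ α, |(linCountAt (toSite rr) Lc μ y (α, x) : ℝ)| := by
  rw [rootCommutator_eq_sum hrr, Finset.mul_sum]
  refine (Finset.abs_sum_le_sum_abs _ _).trans (Finset.sum_le_sum fun x hx => ?_)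
  rw [Finset.mul_sum]
  refine (Finset.abs_sum_le_sum_abs _ _).trans (Finset.sum_le_sum fun α _ => ?_)
  have hJ : 0 ≤ ∑ s ∈ Finset.range n, |G (s + 1) (blk (Lc ^ s) (y + unitVec μ)) - G (s + 1) (blk (Lc ^ s) y)| :=
    Finset.sum_nonneg fun _ _ => abs_nonneg _
  have h1 := hW x hx
  have h2 := hT α x hx
  have hW0 : 0 ≤ W := (abs_nonneg _).trans h1
  have hq := abs_nonneg (linCountAt (toSite rr) Lc μ y (α, x) : ℝ)
  have hloc := abs_rootWeight_staircase_mul_linCountAt_le hLc hrr G n hψ μ y α x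
  rw [abs_mul]
  calc |(ψ ((Lc : ℤ) • y + toSite rr) - ψ x) * (linCountAt (toSite rr) Lc μ y (α, x) : ℝ)| * |T α x|
      ≤ ((W + ∑ s ∈ Finset.range n, |G (s + 1) (blk (Lc ^ s) (y + unitVec μ)) - G (s + 1) (blk (Lc ^ s) y)|)
          * |(linCountAt (toSite rr) Lc μ y (α, x) : ℝ)|) * M :=
        mul_le_mul (hloc.trans (mul_le_mul_of_nonneg_right (by linarith) hq)) h2 (abs_nonneg _) (mul_nonneg (by linarith) hq)
    _ = (W + ∑ s ∈ Finset.range n, |G (s + 1) (blk (Lc ^ s) (y + unitVec μ)) - G (s + 1) (blk (Lc ^ s) y)|) * M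
          * |(linCountAt (toSite rr) Lc μ y (α, x) : ℝ)| := by ring

end Commutator

end Summit.QuantumFields.BalabanUV.Beta.GAN24.ContactFaceJumpBorder

end
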